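import Summits.KontsevichZagierPeriods.KontsevichZagierPeriods.Theorems.SoloInformedParamNL
import HarnessLib

/-!
# Meaning of the Newton–Leibniz clauses

For parametrised terms `T` (dimension `d + 1`), `T'` (dimension `d`) and function terms
`W, A, B` whose graph fibres at the parameter `p` are graphs of functions `F, a, b` (and of `g`,
`g'` for `T`, `T'`) over the relevant fibres, the first-order clauses of `SoloInformedParamNL` say
exactly what the Newton–Leibniz move (3) requires:

* `leClause_iff`    : `∀ x ∈ D(A), a x ≤ b x`;
* `domClauses_iff`  : `(x, t) ∈ D(T) ↔ x ∈ D(A) ∧ a x ≤ t ≤ b x`;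
* `nlClause_iff`    : `g' x = F (x, b x) - F (x, a x)`;
* `contClause_iff`  : `ContinuousOn (t ↦ F (x, t)) [a x, b x]`;
* `derivClause_iff` : `HasDerivAt (s ↦ F (x, s)) (g (x, t)) t` for `t ∈ (a x, b x)`.

References: [cite: KontsevichZagier2001, §1.2 rule (3)]; [cite: BochnakCosteRoy1998, Prop. 2.2.4].
-/

noncomputable section

open Set Filter Topology MeasureTheory Literature.ModelTheory.ExponentialFields
  Literature.NumberTheory.Transcendental

namespace Summit.KontsevichZagierPeriods.KontsevichZagierPeriods.Theorems

namespace SoloInformedPTerm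

variable {K : Type} {d : ℕ} {p : K → ℝ} {T W : SoloInformedPTerm K (d + 1)}
  {T' A B : SoloInformedPTerm K d} {a b g' : (Fin d → ℝ) → ℝ} {F g : (Fin (d + 1) → ℝ) → ℝ}

/-- Squares versus absolute values, strict. [folklore] -/
theorem sq_lt_sq_iff_abs_lt {u v : ℝ} (hv : 0 < v) : u ^ 2 < v ^ 2 ↔ |u| < v := by
  rw [sq_lt_sq, abs_of_pos hv]

/-- Squares versus absolute values, with a nonnegative factor. [folklore] -/
theorem sq_le_mul_sq_iff {u ε v : ℝ} (hε : 0 < ε) : u ^ 2 ≤ ε ^ 2 * v ^ 2 ↔ |u| ≤ ε * |v| := by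
  rw [← mul_pow, sq_le_sq, abs_mul, abs_of_pos hε]

/-! ### `a ≤ b` -/

/-- Meaning of the clause `a ≤ b`. [cite: KontsevichZagier2001, §1.2 rule (3)] -/
theorem leClause_iff (hgA : ∀ x ∈ A.fibre p, ∀ t, Fin.snoc x t ∈ A.gfibre p ↔ t = a x)
    (hgB : ∀ x ∈ A.fibre p, ∀ t, Fin.snoc x t ∈ B.gfibre p ↔ t = b x) :
    SoloInformedLeClause A B p ↔ ∀ x ∈ A.fibre p, a x ≤ b x := by
  constructor
  · intro h x hx
    have := h x ![a x, b x] hx (by simpa using (hgA x hx _).2 rfl)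
      (by simpa using (hgB x hx _).2 rfl)
    simpa using this
  · intro h x w hx h0 h1
    rw [(hgA x hx _).1 h0, (hgB x hx _).1 h1]
    exact h x hx

/-! ### The domain clause -/

/-- Meaning of the two domain clauses. [cite: KontsevichZagier2001, §1.2 rule (3)] -/
theorem domClauses_iff (hgA : ∀ x ∈ A.fibre p, ∀ t, Fin.snoc x t ∈ A.gfibre p ↔ t = a x)
    (hgB : ∀ x ∈ A.fibre p, ∀ t, Fin.snoc x t ∈ B.gfibre p ↔ t = b x) :
    (SoloInformedDomClause₁ T A B p ∧ SoloInformedDomClause₂ T A B p) ↔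
      ∀ (x : Fin d → ℝ) (t : ℝ),
        Fin.snoc x t ∈ T.fibre p ↔ x ∈ A.fibre p ∧ a x ≤ t ∧ t ≤ b x := by
  constructor
  · rintro ⟨h₁, h₂⟩ x t
    constructor
    · intro hxt
      obtain ⟨hx, himp⟩ := h₁ x ![t, a x, b x] (by simpa using hxt)
      have := himp (by simpa using (hgA x hx _).2 rfl) (by simpa using (hgB x hx _).2 rfl)
      simpa using And.intro hx this
    · rintro ⟨hx, hat, htb⟩
      simpa using h₂ x ![t, a x, b x] hx (by simpa using (hgA x hx _).2 rfl)
        (by simpa using (hgB x hx _).2 rfl) (by simpa using hat) (by simpa using htb)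
  · intro h
    refine ⟨fun x w hxt => ?_, fun x w hx h1 h2 hle₁ hle₂ => ?_⟩
    · obtain ⟨hx, hat, htb⟩ := (h x (w 0)).1 hxt
      refine ⟨hx, fun h1 h2 => ?_⟩
      rw [(hgA x hx _).1 h1, (hgB x hx _).1 h2]
      exact ⟨hat, htb⟩
    · rw [(hgA x hx _).1 h1] at hle₁
      rw [(hgB x hx _).1 h2] at hle₂
      exact (h x (w 0)).2 ⟨hx, hle₁, hle₂⟩

/-- The domain clauses give the domain of move (3). [cite: KontsevichZagier2001, §1.2 rule (3)] -/
theorem fibre_eq_of_domClauses (hgA : ∀ x ∈ A.fibre p, ∀ t, Fin.snoc x t ∈ A.gfibre p ↔ t = a x)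
    (hgB : ∀ x ∈ A.fibre p, ∀ t, Fin.snoc x t ∈ B.gfibre p ↔ t = b x)
    (h₁ : SoloInformedDomClause₁ T A B p) (h₂ : SoloInformedDomClause₂ T A B p) :
    T.fibre p = {z | (Fin.init z : Fin d → ℝ) ∈ A.fibre p ∧ a (Fin.init z) ≤ z (Fin.last d) ∧
      z (Fin.last d) ≤ b (Fin.init z)} := by
  ext z
  have h := (domClauses_iff hgA hgB).1 ⟨h₁, h₂⟩ (Fin.init z) (z (Fin.last d))
  rw [Fin.snoc_init_self] at h
  exact h

/-! ### The Newton–Leibniz identity -/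

/-- Meaning of the Newton–Leibniz clause. [cite: KontsevichZagier2001, §1.2 rule (3)] -/
theorem nlClause_iff (hgA : ∀ x ∈ T'.fibre p, ∀ t, Fin.snoc x t ∈ A.gfibre p ↔ t = a x)
    (hgB : ∀ x ∈ T'.fibre p, ∀ t, Fin.snoc x t ∈ B.gfibre p ↔ t = b x)
    (hgWa : ∀ x ∈ T'.fibre p, ∀ v, Fin.snoc (Fin.snoc x (a x)) v ∈ W.gfibre p ↔
      v = F (Fin.snoc x (a x)))
    (hgWb : ∀ x ∈ T'.fibre p, ∀ v, Fin.snoc (Fin.snoc x (b x)) v ∈ W.gfibre p ↔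
      v = F (Fin.snoc x (b x)))
    (hgT' : ∀ x ∈ T'.fibre p, ∀ t, Fin.snoc x t ∈ T'.gfibre p ↔ t = g' x) :
    SoloInformedNLClause T' W A B p ↔
      ∀ x ∈ T'.fibre p, g' x = F (Fin.snoc x (b x)) - F (Fin.snoc x (a x)) := by
  constructor
  · intro h x hx
    have := h x ![a x, b x, F (Fin.snoc x (a x)), F (Fin.snoc x (b x)), g' x] hx
      (by simpa using (hgA x hx _).2 rfl) (by simpa using (hgB x hx _).2 rfl)
      (by simpa using (hgWa x hx _).2 rfl) (by simpa using (hgWb x hx _).2 rfl)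
      (by simpa using (hgT' x hx _).2 rfl)
    simpa using this
  · intro h x w hx h0 h1 h2 h3 h4
    have e0 := (hgA x hx _).1 h0
    have e1 := (hgB x hx _).1 h1
    rw [e0] at h2
    rw [e1] at h3
    rw [(hgT' x hx _).1 h4, (hgWb x hx _).1 h3, (hgWa x hx _).1 h2]
    exact h x hx

/-! ### Continuity -/

/-- **Meaning of the continuity clause.** [cite: KontsevichZagier2001, §1.2 rule (3)] -/
theorem contClause_iff (hgA : ∀ x ∈ A.fibre p, ∀ t, Fin.snoc x t ∈ A.gfibre p ↔ t = a x)
    (hgB : ∀ x ∈ A.fibre p, ∀ t, Fin.snoc x t ∈ B.gfibre p ↔ t = b x)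
    (hgW : ∀ x ∈ A.fibre p, ∀ t, a x ≤ t → t ≤ b x → ∀ v,
      Fin.snoc (Fin.snoc x t) v ∈ W.gfibre p ↔ v = F (Fin.snoc x t)) :
    SoloInformedContClause W A B p ↔
      ∀ x ∈ A.fibre p, ContinuousOn (fun t : ℝ => F (Fin.snoc x t)) (Icc (a x) (b x)) := by
  constructor
  · intro h x hx
    rw [Metric.continuousOn_iff]
    intro t₀ ht₀ ε hε
    obtain ⟨δ, hδ, hall⟩ := h x ![a x, b x, t₀, ε] hx (by simpa using (hgA x hx _).2 rfl)
      (by simpa using (hgB x hx _).2 rfl) (by simpa using ht₀.1) (by simpa using ht₀.2)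
      (by simpa using hε)
    refine ⟨δ 0, hδ, fun t ht hdist => ?_⟩
    have := hall ![t, F (Fin.snoc x t), F (Fin.snoc x t₀)] (by simpa using ht.1)
      (by simpa using ht.2)
      (by simpa [sq_lt_sq_iff_abs_lt hδ, ← Real.dist_eq] using hdist)
      (by simpa using (hgW x hx t ht.1 ht.2 _).2 rfl)
      (by simpa using (hgW x hx t₀ ht₀.1 ht₀.2 _).2 rfl)
    rw [Real.dist_eq, ← sq_lt_sq_iff_abs_lt hε]
    simpa using this
  · intro h x w hx h0 h1 hle₁ hle₂ hε
    have e0 := (hgA x hx _).1 h0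
    have e1 := (hgB x hx _).1 h1
    rw [e0] at hle₁
    rw [e1] at hle₂
    obtain ⟨δ, hδ, hall⟩ := (Metric.continuousOn_iff.1 (h x hx)) (w 2) ⟨hle₁, hle₂⟩ (w 3) hε
    refine ⟨fun _ => δ, hδ, fun y hy₁ hy₂ hyδ hF hF₀ => ?_⟩
    rw [e0] at hy₁
    rw [e1] at hy₂
    rw [(hgW x hx _ hy₁ hy₂ _).1 hF, (hgW x hx _ hle₁ hle₂ _).1 hF₀, sq_lt_sq_iff_abs_lt hε,
      ← Real.dist_eq]
    exact hall (y 0) ⟨hy₁, hy₂⟩ (by rw [Real.dist_eq, ← sq_lt_sq_iff_abs_lt hδ]; exact hyδ)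

/-! ### The derivative -/

/-- The ε–δ form of `HasDerivAt` on the real line. [folklore] -/
theorem hasDerivAt_iff_eps_delta {f : ℝ → ℝ} {f' t₀ : ℝ} : HasDerivAt f f' t₀ ↔
    ∀ ε > 0, ∃ δ > 0, ∀ s, |s - t₀| < δ → |f s - f t₀ - f' * (s - t₀)| ≤ ε * |s - t₀| := by
  rw [hasDerivAt_iff_tendsto, Metric.tendsto_nhds_nhds]
  have key : ∀ s, ‖s - t₀‖⁻¹ * ‖f s - f t₀ - (s - t₀) • f'‖ =
      |s - t₀|⁻¹ * |f s - f t₀ - f' * (s - t₀)| := fun s => by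
    rw [Real.norm_eq_abs, Real.norm_eq_abs, smul_eq_mul, mul_comm (s - t₀) f']
  constructor
  · intro h ε hε
    obtain ⟨δ, hδ, hall⟩ := h ε hε
    refine ⟨δ, hδ, fun s hs => ?_⟩
    rcases eq_or_ne s t₀ with rfl | hne
    · simp
    · have hpos : 0 < |s - t₀| := abs_pos.2 (sub_ne_zero.2 hne)
      have := hall (by rwa [Real.dist_eq])
      rw [key, Real.dist_eq, sub_zero, abs_of_nonneg (by positivity)] at this
      have h2 := mul_lt_mul_of_pos_left this hpos
      rw [mul_inv_cancel_left₀ hpos.ne', mul_comm |s - t₀| ε] at h2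
      exact h2.le
  · intro h ε hε
    obtain ⟨δ, hδ, hall⟩ := h (ε / 2) (half_pos hε)
    refine ⟨δ, hδ, fun {s} hs => ?_⟩
    rw [key, Real.dist_eq, sub_zero, abs_of_nonneg (by positivity)]
    rcases eq_or_ne s t₀ with rfl | hne
    · simpa using hε
    · have hpos : 0 < |s - t₀| := abs_pos.2 (sub_ne_zero.2 hne)
      have := hall s (by rwa [Real.dist_eq] at hs)
      calc |s - t₀|⁻¹ * |f s - f t₀ - f' * (s - t₀)|
          ≤ |s - t₀|⁻¹ * (ε / 2 * |s - t₀|) := by gcongr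
        _ = ε / 2 := by field_simp
        _ < ε := half_lt_self hε

/-- **Meaning of the derivative clause.** [cite: KontsevichZagier2001, §1.2 rule (3)] -/
theorem derivClause_iff (hgA : ∀ x ∈ A.fibre p, ∀ t, Fin.snoc x t ∈ A.gfibre p ↔ t = a x)
    (hgB : ∀ x ∈ A.fibre p, ∀ t, Fin.snoc x t ∈ B.gfibre p ↔ t = b x)
    (hgW : ∀ x ∈ A.fibre p, ∀ s, a x < s → s < b x → ∀ v,
      Fin.snoc (Fin.snoc x s) v ∈ W.gfibre p ↔ v = F (Fin.snoc x s))
    (hgT : ∀ x ∈ A.fibre p, ∀ t, a x < t → t < b x → ∀ v,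
      Fin.snoc (Fin.snoc x t) v ∈ T.gfibre p ↔ v = g (Fin.snoc x t)) :
    SoloInformedDerivClause T W A B p ↔
      ∀ x ∈ A.fibre p, ∀ t ∈ Ioo (a x) (b x),
        HasDerivAt (fun s : ℝ => F (Fin.snoc x s)) (g (Fin.snoc x t)) t := by
  constructor
  · intro h x hx t₀ ht₀
    rw [hasDerivAt_iff_eps_delta]
    intro ε hε
    obtain ⟨δ, hδ, hall⟩ := h x ![a x, b x, t₀, ε, g (Fin.snoc x t₀)] hx
      (by simpa using (hgA x hx _).2 rfl) (by simpa using (hgB x hx _).2 rfl)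
      (by simpa using ht₀.1) (by simpa using ht₀.2) (by simpa using hε)
      (by simpa using (hgT x hx t₀ ht₀.1 ht₀.2 _).2 rfl)
    refine ⟨min (δ 0) (min (t₀ - a x) (b x - t₀)),
      lt_min hδ (lt_min (sub_pos.2 ht₀.1) (sub_pos.2 ht₀.2)), fun s hs => ?_⟩
    have hsδ : |s - t₀| < δ 0 := lt_of_lt_of_le hs (min_le_left _ _)
    have hs1 : a x < s := by
      have := lt_of_lt_of_le hs ((min_le_right _ _).trans (min_le_left _ _))
      rw [abs_sub_lt_iff] at this
      linarith [this.2]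
    have hs2 : s < b x := by
      have := lt_of_lt_of_le hs ((min_le_right _ _).trans (min_le_right _ _))
      rw [abs_sub_lt_iff] at this
      linarith [this.1]
    have := hall ![s, F (Fin.snoc x s), F (Fin.snoc x t₀)] (by simpa using hs1)
      (by simpa using hs2) (by simpa [sq_lt_sq_iff_abs_lt hδ] using hsδ)
      (by simpa using (hgW x hx s hs1 hs2 _).2 rfl)
      (by simpa using (hgW x hx t₀ ht₀.1 ht₀.2 _).2 rfl)
    rw [← sq_le_mul_sq_iff hε]
    simpa using this
  · intro h x w hx h0 h1 hlt₁ hlt₂ hε hγ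
    have e0 := (hgA x hx _).1 h0
    have e1 := (hgB x hx _).1 h1
    rw [e0] at hlt₁
    rw [e1] at hlt₂
    rw [(hgT x hx _ hlt₁ hlt₂ _).1 hγ]
    obtain ⟨δ, hδ, hall⟩ := (hasDerivAt_iff_eps_delta.1 (h x hx (w 2) ⟨hlt₁, hlt₂⟩)) (w 3) hε
    refine ⟨fun _ => δ, hδ, fun y hy₁ hy₂ hyδ hF hF₀ => ?_⟩
    rw [e0] at hy₁
    rw [e1] at hy₂
    rw [(hgW x hx _ hy₁ hy₂ _).1 hF, (hgW x hx _ hlt₁ hlt₂ _).1 hF₀, sq_le_mul_sq_iff hε]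
    exact hall (y 0) (by rw [← sq_lt_sq_iff_abs_lt hδ]; exact hyδ)

end SoloInformedPTerm

end Summit.KontsevichZagierPeriods.KontsevichZagierPeriods.Theorems
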